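import Literature.AlgebraicGeometry.Motives.AbelianVarietyGeneratingSections
import Literature.AlgebraicGeometry.Motives.AbelianVarietyProjectiveChart
import HarnessLib

/-!
# Generating sections with affine non-vanishing loci on an abelian variety (Görtz–Wedhorn II, Lemma 27.175)

Discharge of the named fact `AbelianVariety.existsAffineGeneratingSections k`
(`Motives/AbelianVarietyGeneratingSections`; Görtz–Wedhorn II, Lemma 27.175 / proof of
Prop. 27.174, pp. 880–881): every abelian variety over the algebraically closed field `k` carries
finitely many generating sections of an invertible sheaf whose non-vanishing loci are affine opens
covering it. Since every abelian variety is projective (`AbelianVariety.isProjectiveOver_holds`,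
`Motives/AbelianVarietyProjectiveChart`, proved along the cohomology-free route of Görtz–Wedhorn II,
Thm. 27.71), the coordinate sections `ι^*x₀, …, ι^*xₙ` of a closed immersion `ι : X ↪ ℙⁿ_k` are such
sections (Hartshorne II Thm. 7.1 (a): `GeneratingSections.ofHom`,
`Motives/ProjectiveOfGeneratingSections`), their non-vanishing loci `ι⁻¹D₊(xᵢ)` being affine because
a closed immersion is an affine morphism (`GeneratingSections.isAffineOpen_ofHom_U`).

* `AbelianVariety.existsAffineGeneratingSections_holds` — the discharge.

No named facts are introduced. Mathlib searched (pin): `IsClosedImmersion` ⇒ `IsAffineHom`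
(instance, used), `Proj.isAffineOpen_basicOpen` (through the tree).

## References

* U. Görtz, T. Wedhorn, *Algebraic Geometry II: Cohomology of Schemes*, Springer Spektrum (2023),
  doi:10.1007/978-3-658-43031-3: Prop. 27.174 and Lemma 27.175, pp. 880–881 (read via the held
  copy). [GortzWedhorn2023]
* R. Hartshorne, *Algebraic Geometry*, GTM 52, Springer (1977): II Thm. 7.1 (a). [Hartshorne1977]
-/

universe u

open CategoryTheory AlgebraicGeometry
open Literature.AlgebraicGeometry.Motives.Segre

noncomputable section

namespace Literature.AlgebraicGeometry.Motives

attribute [local instance] MvPolynomial.gradedAlgebra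

namespace AbelianVariety

/-- **Görtz–Wedhorn II, Lemma 27.175 (generating sections with affine non-vanishing loci), for every
abelian variety over an algebraically closed field** — discharge of the named fact
`AbelianVariety.existsAffineGeneratingSections k`: pull the coordinate sections back along a projective
embedding (`AbelianVariety.isProjectiveOver_holds`, `GeneratingSections.ofHom`); their non-vanishing
loci `ι⁻¹D₊(xᵢ)` are affine for the affine morphism `ι`.
[cite: GortzWedhorn2023, Lemma 27.175 and Prop. 27.174 (pp. 880–881)] -/
theorem existsAffineGeneratingSections_holds {k : Type u} [Field k] [IsAlgClosed k] :
    existsAffineGeneratingSections k := by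
  intro X
  obtain ⟨n, ι, hι⟩ := AbelianVariety.isProjectiveOver_holds X
  haveI : IsClosedImmersion ι.left := hι
  haveI : @IsAffineHom X.X.left (Proj (grading (Fin (n + 1)) k)) ι.left :=
    (inferInstance : IsAffineHom ι.left)
  exact ⟨n, GeneratingSections.ofHom (k := k) (ι := Fin (n + 1)) ι.left,
    GeneratingSections.isAffineOpen_ofHom_U (k := k) (ι := Fin (n + 1)) ι.left⟩

end AbelianVariety

end Literature.AlgebraicGeometry.Motives

end
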